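import Literature.Probability.RandomPlanarGeometry.HexSAWSurfaceWallDelayedRenewal
import Literature.Probability.RandomPlanarGeometry.HexSAWSurfaceWallRenewalKendall
import HarnessLib

/-!
# A geometric RATE in the DELAYED renewal theorem for ALL wall bridges of adsorbed honeycomb surface walks, for EVERY `y > μ⁴`

Lane pcv-sawmu, a-idea-1 gen 29, car 49 «KENDALL-DELAYED». CLASS D on `HexSAWSurfaceWallDelayedRenewal` (the delayed
renewal structure of all wall bridges: `wbAmp`, `dwbLaw`, `dwbSum`, `tendsto_wbAmp`, and the rate in `_of` form
`abs_wbAmp_sub_lim_le`) and on `HexSAWSurfaceWallRenewalKendall` (Kendall's rate for the positive wall bridges at every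
`y > μ⁴`: `exists_geometric_rate_pwbAmp`).

Setting (tree): for real `y` and `s : ℕ`, `W_{2s}(y) = WB (2s) y` is the surface-weighted count of ALL wall bridges of
length `2s`, `β(y) = wallRate y`, `w_s(y) = wbAmp y s = W_{2s}(y)/β(y)^{2s}`; `d(y) = dwbSum y` is the (finite, `≥ 1`) delay
mass and `m(y) = pwbMean y` the mean wall-renewal time. `HexSAWSurfaceWallDelayedRenewal.tendsto_wbAmp` gives
`w_s(y) → d(y)/m(y)` for `y > μ⁴` with NO rate in general; its `abs_wbAmp_sub_lim_le` turns ANY geometric rate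
`|u_j − 1/m| ≤ A κ^j` (`θ = μ²/√y ≤ κ < 1`) for the positive wall bridges into the rate
`|w_s − d/m| ≤ (μ²√y·A·(s+1) + μ²√y·κ/(1−κ)/m)·κ^s`, and its closed form `abs_wbAmp_sub_lim_le_of_tails` needs Feller's
`G(ρ) < 1` (large `y` only). `HexSAWSurfaceWallRenewalKendall.exists_geometric_rate_pwbAmp` supplies such a rate for EVERY
`y > μ⁴` (Kendall's theorem).

## Results (every real `y > μ⁴ = 6 + 4√2 ≈ 11.66`; hypothesis-free beyond that)

* ★ `exists_linear_geometric_rate_wbAmp` — `∃ κ ∈ (0,1), ∃ C, ∀ s, |wbAmp y s − dwbSum y · (pwbMean y)⁻¹| ≤ C·(s+1)·κ^s`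
  (with `κ = max(θ, ρ⁻¹)` from Kendall's radius `ρ`).
* ★ `exists_geometric_rate_wbAmp` — `∃ κ ∈ (0,1), ∃ C, ∀ s, |wbAmp y s − dwbSum y · (pwbMean y)⁻¹| ≤ C·κ^s` (the factor
  `s+1` absorbed: `(s+1)t^s ≤ 1/(1−t)` applied with `t = κ/κ'`, `κ' = (1+κ)/2`), and the same in the spelling
  `W_{2s}(y)/β(y)^{2s}` (`exists_geometric_rate_WB_div`).

Honest label: COROLLARY (XS/D) — the delayed renewal theorem WITH GEOMETRIC RATE (Madras–Slade Theorem 4.2.2(b) /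
Appendix B with a genuine delay, Feller XIII.5) for all wall bridges of the adsorbed phase at EVERY `y > μ⁴`, obtained by
feeding the Kendall rate of `HexSAWSurfaceWallRenewalKendall` into the `_of`-form rate of `HexSAWSurfaceWallDelayedRenewal`;
new in writing only as the removal of the regime hypothesis `G(ρ) < 1`; mechanism = the parents'. No numerics claimed (the
exhibited `κ(y)` is as poor near `μ⁴` as Kendall's radius: `1 − κ ≈ 10⁻¹¹` at `y = 13`, `≈ 10⁻³` at `y = 100`, floats).

Primary sources: [cite: MadrasSlade1993, §4.2 Theorem 4.2.2(b) (pp. 91–92), Theorem 4.2.5 (p. 95), Appendix B proof of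
Theorem B.1 (pp. 390–392)]; [cite: Feller1968, XIII.5 (delayed recurrent events), XIII.10]; [cite: Bednorz2013, §2 Corollary 2.5
(p. 5)] (the quantitative Kendall theorem behind the parent's rate); [cite: BeatonBousquetMelouDeGierDuminilCopinGuttmann2014, §3.1]
(the wall-bridge decomposition of the honeycomb surface model).
-/

noncomputable section

open Finset Filter
open _root_.Topology

namespace Literature.Probability.RandomPlanarGeometry.SAW.HexBW.Wall

variable {y : ℝ}

/-- [folklore] `0 < θ(y) = μ²/√y < 1` and `0 < y` for `μ⁴ < y`. [cite: MadrasSlade1993, §4.2, remark before (4.2.21) (p. 94)] -/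
private theorem theta_facts_wdk (hy : hexConnectiveConstant ^ 4 < y) :
    0 < y ∧ 0 < hexConnectiveConstant ^ 2 / Real.sqrt y ∧ hexConnectiveConstant ^ 2 / Real.sqrt y < 1 := by
  have hμ1 : 1 < hexConnectiveConstant := HV.one_lt_hexConnectiveConstant
  have hy0 : 0 < y := lt_trans (by positivity) hy
  have hμ := hexConnectiveConstant_pos
  refine ⟨hy0, div_pos (pow_pos hμ 2) (Real.sqrt_pos.2 hy0), ?_⟩
  rw [div_lt_one (Real.sqrt_pos.2 hy0), Real.lt_sqrt (by positivity)]
  calc (hexConnectiveConstant ^ 2) ^ 2 = hexConnectiveConstant ^ 4 := by ring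
    _ < y := hy

/-- [folklore] the elementary absorption inequality `(s+1)·t^s ≤ 1/(1−t)` for `0 ≤ t < 1`
(`(s+1)t^s ≤ Σ_{k ≤ s} t^k ≤ 1/(1−t)`). [cite: Feller1968, XIII.10] -/
private theorem succ_mul_pow_le_wdk {t : ℝ} (ht0 : 0 ≤ t) (ht1 : t < 1) (s : ℕ) :
    ((s : ℝ) + 1) * t ^ s ≤ 1 / (1 - t) := by
  have hsum : ((s : ℝ) + 1) * t ^ s ≤ ∑ k ∈ range (s + 1), t ^ k := by
    calc ((s : ℝ) + 1) * t ^ s = ∑ _k ∈ range (s + 1), t ^ s := by simp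
      _ ≤ ∑ k ∈ range (s + 1), t ^ k :=
          Finset.sum_le_sum fun k hk => pow_le_pow_of_le_one ht0 ht1.le (Nat.lt_succ_iff.1 (mem_range.1 hk))
  have hgeom : ∑ k ∈ range (s + 1), t ^ k ≤ 1 / (1 - t) := by
    rw [le_div_iff₀ (by linarith : (0 : ℝ) < 1 - t), geom_sum_mul_neg]
    linarith [pow_nonneg ht0 (s + 1)]
  exact hsum.trans hgeom

/-- **Delayed renewal theorem with a LINEAR-GEOMETRIC rate, every `y > μ⁴`**: there are `κ ∈ (0,1)` and `C` with
`|W_{2s}(y) β(y)^{-2s} − d(y)/m(y)| ≤ C·(s+1)·κ^s` for all `s` — `HexSAWSurfaceWallDelayedRenewal.abs_wbAmp_sub_lim_le` fed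
with Kendall's rate `HexSAWSurfaceWallRenewalKendall.exists_geometric_rate_pwbAmp` at `κ = max(θ, ρ⁻¹)`.
[cite: MadrasSlade1993, §4.2 Theorem 4.2.2(b) (pp. 91–92) and Appendix B, proof of Theorem B.1 (pp. 390–392)] [cite: Feller1968, XIII.5] -/
theorem exists_linear_geometric_rate_wbAmp (hy : hexConnectiveConstant ^ 4 < y) :
    ∃ κ : ℝ, 0 < κ ∧ κ < 1 ∧ ∃ C : ℝ, ∀ s : ℕ,
      |wbAmp y s - dwbSum y * (pwbMean y)⁻¹| ≤ C * ((s : ℝ) + 1) * κ ^ s := by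
  obtain ⟨_, hθ0, hθ1⟩ := theta_facts_wdk hy
  obtain ⟨ρ, hρ, K, hK⟩ := exists_geometric_rate_pwbAmp hy
  set θ := hexConnectiveConstant ^ 2 / Real.sqrt y with hθ
  have hρ0 : 0 < ρ := by linarith
  have hρi0 : 0 < ρ⁻¹ := inv_pos.2 hρ0
  have hρi1 : ρ⁻¹ < 1 := inv_lt_one_of_one_lt₀ hρ
  have hK0 : 0 ≤ K := le_trans (abs_nonneg _) (by simpa using hK 0)
  set κ := max θ ρ⁻¹ with hκ
  have hκ0 : 0 < κ := lt_max_of_lt_left hθ0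
  have hκ1 : κ < 1 := max_lt hθ1 hρi1
  have hu : ∀ j, |pwbAmp y j - (pwbMean y)⁻¹| ≤ K * κ ^ j := fun j =>
    (hK j).trans (mul_le_mul_of_nonneg_left (pow_le_pow_left₀ hρi0.le (le_max_right _ _) j) hK0)
  refine ⟨κ, hκ0, hκ1, hexConnectiveConstant ^ 2 * Real.sqrt y * K +
    hexConnectiveConstant ^ 2 * Real.sqrt y * κ / (1 - κ) * (pwbMean y)⁻¹, fun s => ?_⟩
  have h := abs_wbAmp_sub_lim_le hy (le_max_left _ _) hκ1 hu s
  have hC2 : 0 ≤ hexConnectiveConstant ^ 2 * Real.sqrt y * κ / (1 - κ) * (pwbMean y)⁻¹ :=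
    mul_nonneg (div_nonneg (by positivity) (by linarith)) (inv_nonneg.2 (pwbMean_pos hy).le)
  calc |wbAmp y s - dwbSum y * (pwbMean y)⁻¹|
      ≤ (hexConnectiveConstant ^ 2 * Real.sqrt y * K * (s + 1) +
          hexConnectiveConstant ^ 2 * Real.sqrt y * κ / (1 - κ) * (pwbMean y)⁻¹) * κ ^ s := h
    _ ≤ (hexConnectiveConstant ^ 2 * Real.sqrt y * K * (s + 1) +
          hexConnectiveConstant ^ 2 * Real.sqrt y * κ / (1 - κ) * (pwbMean y)⁻¹ * (s + 1)) * κ ^ s := by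
        apply mul_le_mul_of_nonneg_right _ (pow_nonneg hκ0.le s)
        exact add_le_add le_rfl (le_mul_of_one_le_right hC2 (le_add_of_nonneg_left (Nat.cast_nonneg s)))
    _ = (hexConnectiveConstant ^ 2 * Real.sqrt y * K +
          hexConnectiveConstant ^ 2 * Real.sqrt y * κ / (1 - κ) * (pwbMean y)⁻¹) * ((s : ℝ) + 1) * κ ^ s := by ring

/-- **Delayed renewal theorem with a GEOMETRIC rate, every `y > μ⁴`**: there are `κ ∈ (0,1)` and `C` with
`|W_{2s}(y) β(y)^{-2s} − d(y)/m(y)| ≤ C·κ^s` for all `s` (the linear factor of `exists_linear_geometric_rate_wbAmp`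
absorbed into the ratio: `κ' = (1+κ)/2`, `(s+1)(κ/κ')^s ≤ 1/(1 − κ/κ')`).
[cite: MadrasSlade1993, §4.2 Theorem 4.2.2(b) (pp. 91–92), Theorem 4.2.5 (p. 95)] [cite: Feller1968, XIII.5 and XIII.10] -/
theorem exists_geometric_rate_wbAmp (hy : hexConnectiveConstant ^ 4 < y) :
    ∃ κ : ℝ, 0 < κ ∧ κ < 1 ∧ ∃ C : ℝ, ∀ s : ℕ, |wbAmp y s - dwbSum y * (pwbMean y)⁻¹| ≤ C * κ ^ s := by
  obtain ⟨κ, hκ0, hκ1, C, hC⟩ := exists_linear_geometric_rate_wbAmp hy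
  have hC0 : 0 ≤ C := by
    have h0 := hC 0
    simp only [Nat.cast_zero, zero_add, mul_one, pow_zero] at h0
    exact (abs_nonneg _).trans h0
  set κ' := (1 + κ) / 2 with hκ'
  have hκ'0 : 0 < κ' := by rw [hκ']; linarith
  have hκκ' : κ < κ' := by rw [hκ']; linarith
  have hκ'1 : κ' < 1 := by rw [hκ']; linarith
  set t := κ / κ' with ht
  have ht0 : 0 ≤ t := div_nonneg hκ0.le hκ'0.le
  have ht1 : t < 1 := (div_lt_one hκ'0).2 hκκ'
  have hκt : κ = t * κ' := by rw [ht]; field_simp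
  refine ⟨κ', hκ'0, hκ'1, C * (1 / (1 - t)), fun s => (hC s).trans ?_⟩
  calc C * ((s : ℝ) + 1) * κ ^ s = C * (((s : ℝ) + 1) * t ^ s) * κ' ^ s := by rw [hκt, mul_pow]; ring
    _ ≤ C * (1 / (1 - t)) * κ' ^ s := by
        gcongr
        exact succ_mul_pow_le_wdk ht0 ht1 s

/-- The same rate in the spelling `W_{2s}(y)/β(y)^{2s}`: for every `y > μ⁴` there are `κ ∈ (0,1)` and `C` with
`|WB (2s) y / wallRate y ^ (2s) − dwbSum y · (pwbMean y)⁻¹| ≤ C κ^s` for all `s`.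
[cite: MadrasSlade1993, §4.2 Theorem 4.2.2(b) (pp. 91–92)] [cite: BeatonBousquetMelouDeGierDuminilCopinGuttmann2014, §3.1] -/
theorem exists_geometric_rate_WB_div (hy : hexConnectiveConstant ^ 4 < y) :
    ∃ κ : ℝ, 0 < κ ∧ κ < 1 ∧ ∃ C : ℝ, ∀ s : ℕ,
      |WB (2 * s) y / wallRate y ^ (2 * s) - dwbSum y * (pwbMean y)⁻¹| ≤ C * κ ^ s :=
  exists_geometric_rate_wbAmp hy

end Literature.Probability.RandomPlanarGeometry.SAW.HexBW.Wall

end
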